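import Literature.InformationTheory.QuantumCodes.TwoBlockCodeDistanceBounds
import Mathlib.GroupTheory.Coset.Basic
import HarnessLib

/-!
# `d ≤ min(|G_a|, |G_b|)` for every two-block group-algebra code `LP[a,b]` with `k > 0` over an arbitrary
# finite group (Lin–Pryadko 2024, §IV.E via Statement 4) — proved WITHOUT the printed rank-defect hypothesis

Source: H.-K. Lin, L. P. Pryadko, *Quantum two-block group algebra codes*, Phys. Rev. A **109** (2024) 022407 =
arXiv:2306.16400 [LinPryadko2024]; held text `paper:arxiv-2306.16400`, §IV.C (chunk p0009 L116–135, p0010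
L14–22) and §IV.E (chunk p0011 L61–70), read on the page:

> "With this choice, it is easy to see from Eq. (10) that the `m_a` blocks of the matrix `A` associated with
> different cosets are identical, `A = A₁ ⊗ I_{m_a}`, where `A₁ ≡ L_{G_a}(a)` … The same is true for the matrix
> `B`" (p0010 L14–26) — `L(a)` is block-diagonal on the right cosets of the support group
> `G_a ≡ ⟨{g ∈ G : a_g ≠ 0}⟩` (p0009 L116–121), `R(b)` on the left cosets of `G_b`;
> "The semi-abelian 2BGA codes whose CSS generator matrices have the property `δ_X = δ_Z = 0` are special …
> this gives a lower distance bound (23) …, and guarantees the condition of Statement 4, giving a simple upper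
> bound on the distance in terms of matrix block sizes, `d ≤ min(|G_a|, |G_b|)`." (p0011 L61–70)

## What is PROVED (tree objects `TwoBlockGA.leftMul/rightMul/HX/HZ/css` of `TwoBlockGroupAlgebraCodes.lean`,
## `TwoBlock.statement4` etc. of `TwoBlockCodeDistanceBounds.lean`)

* `TwoBlockGA.suppGroup a = ⟨supp a⟩` (`G_a`); block-diagonality: `leftMul_eq_zero_of_rcLabel_ne` (`L(a)_{αβ} ≠
  0 ⟹ G_a α = G_a β`), `rightMul_eq_zero_of_lcLabel_ne` (`R(b)_{αβ} ≠ 0 ⟹ α G_b = β G_b`) and the transposed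
  forms; block sizes `card_filter_rcLabel` / `card_filter_lcLabel` (`= |G_a|`, `|G_b|`) — any coefficient ring.
* `TwoBlock.exists_not_mem_map_of_ker_inf_ne_bot` (any field, commuting `M, N`): `ker M ∩ ker N ≠ 0 ⟹` the
  single-block `Z`-shortened code `Q''` is non-trivial (`ker M ⊄ N(ker M)`: a surjective endomorphism of
  `ker M` would be injective).
* `TwoBlockGA.exists_zLogical_wt_le_left/right`, `exists_xLogical_wt_le_left/right` (any field): if
  `ker L(a) ∩ ker R(b) ≠ 0` there are non-trivial `Z`-codewords `(u;0)` with `wgt u ≤ |G_a|` and `(0;v)` with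
  `wgt v ≤ |G_b|`; if `ker L(a)ᵀ ∩ ker R(b)ᵀ ≠ 0` the same for `X`-codewords — Statement 4 applied to the four
  block-diagonal matrices `L(a)`, `R(b)`, `R(b)ᵀ`, `L(a)ᵀ` (Statement 3 (b) pads single-block words).
* **`TwoBlockGA.css_min_dX_dZ_le_card_suppGroup`** (binary `LP[a,b] = TwoBlockGA.css a b`, ANY finite group):
  `k > 0 ⟹ min(d_X, d_Z) ≤ min(|G_a|, |G_b|)`, because `k = dim(ker A ∩ ker B) + dim(ker Aᵀ ∩ ker Bᵀ)`
  (`TwoBlock.dim_eq_finrank_ker_inf_add`) forces one of the two kernels to be non-zero; sector forms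
  `css_dZ_le_card_suppGroup` (`dim(ker A ∩ ker B) > 0`), `css_dX_le_card_suppGroup`; census form
  `TwoBlockGA.le_card_suppGroup_of_isCode` (`[[n,k,d]] ⟹ d ≤ |G_a| ∧ d ≤ |G_b|`).

DEVIATION FROM PRINT (declared): the text derives `d ≤ min(|G_a|,|G_b|)` for codes with `δ_X = δ_Z = 0`
("guarantees the condition of Statement 4"); here the condition of Statement 4 — non-triviality of `Q''_L`,
resp. `Q''_R`, i.e. `k(Q'') = dim(ker A ∩ ker B) > 0` — is obtained directly from `k > 0` in at least one
sector, so NO rank-defect hypothesis is needed and the bound holds for every 2BGA code with `k > 0` (abelian: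
every GB / BB / abelian 2BGA code; the abelian packaging through `TwoBlockGA.css_params_eq_abelian` is left to
users). No named facts, no instances, no notation; decidability of coset membership is only used inside
proofs (`classical`).

## References (locators read on the page)
* [LinPryadko2024] arXiv:2306.16400 §IV.C `G_a ≡ ⟨{g ∈ G : a_g ≠ 0}⟩`, `A = A₁ ⊗ I_{m_a}` (chunks p0009
  L116–121, p0010 L14–26); §IV.E "d ≤ min(|G_a|,|G_b|)" (chunk p0011 L61–70); Statement 4 (chunk p0007 L71–76).
-/

namespace Literature.InformationTheory.QuantumCodes

open Matrix Module
open Literature.InformationTheory.Coding (hammingNorm_sumElim)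

/-! ### Non-triviality of the `Z`-shortened code from a common kernel vector (any field) -/

namespace TwoBlock

variable {F : Type*} [Field F] {ι : Type*} [Fintype ι]

/-- For commuting `M, N`: if `ker M ∩ ker N ≠ 0` then `ker M ⊄ N(ker M)`, i.e. the single-block `Z`-shortened
code `Q'' = css(M, N(I − F_M))` is non-trivial (`k(Q'') = dim(ker M ∩ ker N) > 0`): otherwise `N` restricted
to `ker M` would be a surjective, hence injective, endomorphism killing a non-zero vector.
[cite: LinPryadko2024, Statement 4 hypothesis "the code Q_L'' is non-trivial, k(Q_L'') > 0" (arXiv:2306.16400 chunk p0007 L71–76)] -/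
theorem exists_not_mem_map_of_ker_inf_ne_bot {M N : Matrix ι ι F} (hMN : M * N = N * M)
    (h : LinearMap.ker M.mulVecLin ⊓ LinearMap.ker N.mulVecLin ≠ ⊥) :
    ∃ u, M *ᵥ u = 0 ∧ u ∉ (LinearMap.ker M.mulVecLin).map N.mulVecLin := by
  by_contra hcon
  push Not at hcon
  have hmaps : ∀ x ∈ LinearMap.ker M.mulVecLin, N.mulVecLin x ∈ LinearMap.ker M.mulVecLin := by
    intro x hx
    rw [LinearMap.mem_ker, Matrix.mulVecLin_apply] at hx ⊢
    rw [Matrix.mulVecLin_apply, mulVec_mulVec, hMN, ← mulVec_mulVec, hx, mulVec_zero]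
  set f := N.mulVecLin.restrict hmaps with hf
  have hsurj : Function.Surjective f := by
    rintro ⟨y, hy⟩
    have hy' : M *ᵥ y = 0 := by rwa [LinearMap.mem_ker, Matrix.mulVecLin_apply] at hy
    obtain ⟨x, hx, hxy⟩ := hcon y hy'
    exact ⟨⟨x, hx⟩, Subtype.ext hxy⟩
  have hinj : Function.Injective f := LinearMap.injective_iff_surjective.2 hsurj
  obtain ⟨w, hw, hw0⟩ := (Submodule.ne_bot_iff _).1 h
  apply hw0
  have hwM : w ∈ LinearMap.ker M.mulVecLin := (Submodule.mem_inf.1 hw).1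
  have hwN : N *ᵥ w = 0 := LinearMap.mem_ker.1 (Submodule.mem_inf.1 hw).2
  have h1 : f ⟨w, hwM⟩ = 0 := by
    apply Subtype.ext
    rw [hf, LinearMap.restrict_apply]
    simpa using hwN
  have h2 : (⟨w, hwM⟩ : LinearMap.ker M.mulVecLin) = 0 := hinj (by rw [h1, map_zero])
  exact congrArg Subtype.val h2

variable [DecidableEq F]

/-- **Statement 4 with its non-triviality hypothesis supplied by a common kernel vector** (any field): for
commuting `A, B` with `A` block-diagonal (blocks of size `≤ m`) and `ker A ∩ ker B ≠ 0` there is a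
non-trivial `Z`-codeword `(u; 0)` of the two-block code, `u ∈ ker A ∖ B(ker A)`, supported in one block,
`wgt u ≤ m`. [cite: LinPryadko2024, Statement 4 (arXiv:2306.16400 chunk p0007 L71–76)] -/
theorem exists_mem_ker_not_mem_map_wt_le {A B : Matrix ι ι F} (hAB : A * B = B * A) {β : Type*}
    [DecidableEq β] {blk : ι → β} (hA : ∀ i j, blk i ≠ blk j → A i j = 0) {m : ℕ}
    (hm : ∀ b, (Finset.univ.filter fun i => blk i = b).card ≤ m)
    (h : LinearMap.ker A.mulVecLin ⊓ LinearMap.ker B.mulVecLin ≠ ⊥) :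
    ∃ u, A *ᵥ u = 0 ∧ u ∉ (LinearMap.ker A.mulVecLin).map B.mulVecLin ∧ hammingNorm u ≤ m := by
  obtain ⟨u, hu, hu'⟩ := exists_not_mem_map_of_ker_inf_ne_bot hAB h
  obtain ⟨b, hb, hb'⟩ := statement4 hA hu hu'
  exact ⟨_, hb, hb', (hammingNorm_blockRestrict_le blk b u).trans (hm b)⟩

omit [DecidableEq F] in
/-- Statement 3 (b), right block: `v ∈ ker B ∖ A(ker B)` pads to the non-trivial `Z`-codeword `(0; v)`.
[cite: LinPryadko2024, Statement 3 "the case μ = R is similar" (arXiv:2306.16400 chunks p0007 L51–63, p0016 L38–40)] -/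
theorem statement3b_right {A B : Matrix ι ι F} {v : ι → F} (hv : B *ᵥ v = 0)
    (hv' : v ∉ (LinearMap.ker B.mulVecLin).map A.mulVecLin) :
    Sum.elim (0 : ι → F) v ∈ pcCode (HX A B) ∧ Sum.elim (0 : ι → F) v ∉ rowSpace (HZ A B) := by
  refine ⟨(mem_pcCode_HX_iff A B 0 v).2 (by rw [hv, mulVec_zero, add_zero]), fun h => hv' ?_⟩
  obtain ⟨s, hs, hs'⟩ := (mem_rowSpace_HZ_iff A B 0 v).1 h
  refine ⟨-s, ?_, by rw [Matrix.mulVecLin_apply, mulVec_neg, hs']⟩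
  change B *ᵥ (-s) = 0
  rw [mulVec_neg, hs, neg_zero]

omit [DecidableEq F] in
/-- `X`-type analogue of Statement 3 (b), left block: `u ∈ ker Bᵀ ∖ Aᵀ(ker Bᵀ)` pads to the non-trivial
`X`-codeword `(u; 0)` (`Bᵀu = Aᵀ0`; `(u;0) = (Aᵀt; Bᵀt)` would force `Bᵀt = 0`).
[cite: LinPryadko2024, App. A.5 "CSS symmetry combined with the block permutation symmetry gives the other bound" (arXiv:2306.16400 chunk p0016 L90–93)] -/
theorem statement3b_X_left {A B : Matrix ι ι F} {u : ι → F} (hu : Bᵀ *ᵥ u = 0)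
    (hu' : u ∉ (LinearMap.ker Bᵀ.mulVecLin).map Aᵀ.mulVecLin) :
    Sum.elim u (0 : ι → F) ∈ pcCode (HZ A B) ∧ Sum.elim u (0 : ι → F) ∉ rowSpace (HX A B) := by
  refine ⟨(mem_pcCode_HZ_iff A B u 0).2 (by rw [hu, mulVec_zero]), fun h => hu' ?_⟩
  obtain ⟨t, ht, ht'⟩ := (mem_rowSpace_HX_iff A B u 0).1 h
  exact ⟨t, by change Bᵀ *ᵥ t = 0; exact ht', ht⟩

omit [DecidableEq F] in
/-- `X`-type analogue, right block: `v ∈ ker Aᵀ ∖ Bᵀ(ker Aᵀ)` pads to the non-trivial `X`-codeword `(0; v)`.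
[cite: LinPryadko2024, App. A.5 (arXiv:2306.16400 chunk p0016 L90–93)] -/
theorem statement3b_X_right {A B : Matrix ι ι F} {v : ι → F} (hv : Aᵀ *ᵥ v = 0)
    (hv' : v ∉ (LinearMap.ker Aᵀ.mulVecLin).map Bᵀ.mulVecLin) :
    Sum.elim (0 : ι → F) v ∈ pcCode (HZ A B) ∧ Sum.elim (0 : ι → F) v ∉ rowSpace (HX A B) := by
  refine ⟨(mem_pcCode_HZ_iff A B 0 v).2 (by rw [hv, mulVec_zero]), fun h => hv' ?_⟩
  obtain ⟨t, ht, ht'⟩ := (mem_rowSpace_HX_iff A B 0 v).1 h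
  exact ⟨t, by change Aᵀ *ᵥ t = 0; exact ht, ht'⟩

end TwoBlock

/-! ### Support groups and the coset block structure of `L(a)`, `R(b)` -/

namespace TwoBlockGA

variable {G : Type*} [Group G] {R : Type*}

/-- The support group `G_a ≡ ⟨{g ∈ G : a_g ≠ 0}⟩` of a group-algebra element.
[cite: LinPryadko2024, §IV.C "G_a ≡ ⟨{g ∈ G : a_g ≠ 0}⟩" (arXiv:2306.16400 chunk p0009 L116–121)] -/
def suppGroup [Zero R] (a : G → R) : Subgroup G := Subgroup.closure {g | a g ≠ 0}

/-- `supp a ⊆ G_a`. [cite: LinPryadko2024, §IV.C (arXiv:2306.16400 chunk p0009 L116–121)] -/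
theorem mem_suppGroup_of_ne_zero [Zero R] {a : G → R} {g : G} (h : a g ≠ 0) : g ∈ suppGroup a :=
  Subgroup.subset_closure h

/-- Right-coset label of `α` modulo `H` (written as the left coset of `α⁻¹`, so that `G ⧸ H` can be used):
`rcLabel H α = rcLabel H β ⟺ αβ⁻¹ ∈ H ⟺ Hα = Hβ`. [cite: LinPryadko2024, §IV.C "elements of each right coset G_a x" (arXiv:2306.16400 chunk p0010 L14–22)] -/
def rcLabel (H : Subgroup G) (α : G) : G ⧸ H := ((α⁻¹ : G) : G ⧸ H)

/-- Left-coset label `α ↦ αK`. [cite: LinPryadko2024, §IV.C "x G_b the right [sic: left-multiplied] cosets" (arXiv:2306.16400 chunk p0009 L132–135)] -/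
def lcLabel (K : Subgroup G) (α : G) : G ⧸ K := ((α : G) : G ⧸ K)

/-- `rcLabel H α = rcLabel H β ⟺ αβ⁻¹ ∈ H`. [cite: LinPryadko2024, §IV.C (arXiv:2306.16400 chunk p0010 L14–22)] -/
theorem rcLabel_eq_iff {H : Subgroup G} {α β : G} : rcLabel H α = rcLabel H β ↔ α * β⁻¹ ∈ H := by
  rw [rcLabel, rcLabel, QuotientGroup.eq, inv_inv]

/-- `lcLabel K α = lcLabel K β ⟺ α⁻¹β ∈ K`. [cite: LinPryadko2024, §IV.C (arXiv:2306.16400 chunk p0009 L132–135)] -/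
theorem lcLabel_eq_iff {K : Subgroup G} {α β : G} : lcLabel K α = lcLabel K β ↔ α⁻¹ * β ∈ K := by
  rw [lcLabel, lcLabel, QuotientGroup.eq]

/-- **`L(a)` is block-diagonal on the right cosets of any subgroup containing `supp a`** (`L(a)_{αβ} = a(αβ⁻¹)
≠ 0 ⟹ αβ⁻¹ ∈ H`). [cite: LinPryadko2024, §IV.C "the m_a blocks of the matrix A associated with different cosets are identical, A = A₁ ⊗ I_{m_a}" (arXiv:2306.16400 chunk p0010 L14–22)] -/
theorem leftMul_eq_zero_of_rcLabel_ne [Zero R] {a : G → R} {H : Subgroup G}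
    (hH : ∀ g, a g ≠ 0 → g ∈ H) (α β : G) (hne : rcLabel H α ≠ rcLabel H β) : leftMul a α β = 0 := by
  by_contra h
  exact hne (rcLabel_eq_iff.2 (hH _ (by rwa [leftMul_apply] at h)))

/-- `L(a)ᵀ` is block-diagonal on the same right cosets (`(L(a)ᵀ)_{αβ} = a(βα⁻¹)`).
[cite: LinPryadko2024, §IV.C "Since transposition does not change the support group, G_{â} = G_a" (arXiv:2306.16400 chunk p0010 L3–6)] -/
theorem transpose_leftMul_eq_zero_of_rcLabel_ne [Zero R] {a : G → R} {H : Subgroup G}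
    (hH : ∀ g, a g ≠ 0 → g ∈ H) (α β : G) (hne : rcLabel H α ≠ rcLabel H β) : (leftMul a)ᵀ α β = 0 := by
  rw [transpose_apply]
  exact leftMul_eq_zero_of_rcLabel_ne hH β α (Ne.symm hne)

/-- **`R(b)` is block-diagonal on the left cosets of any subgroup containing `supp b`** (`R(b)_{αβ} =
b(β⁻¹α) ≠ 0 ⟹ β⁻¹α ∈ K`). [cite: LinPryadko2024, §IV.C "The same is true for the matrix B, except … B = S(I_{m_b} ⊗ B₁)S⁻¹" (arXiv:2306.16400 chunk p0010 L22–26)] -/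
theorem rightMul_eq_zero_of_lcLabel_ne [Zero R] {b : G → R} {K : Subgroup G}
    (hK : ∀ g, b g ≠ 0 → g ∈ K) (α β : G) (hne : lcLabel K α ≠ lcLabel K β) : rightMul b α β = 0 := by
  by_contra h
  refine hne (lcLabel_eq_iff.2 ?_)
  have h' : β⁻¹ * α ∈ K := hK _ (by rwa [rightMul_apply] at h)
  have := K.inv_mem h'
  rwa [_root_.mul_inv_rev, inv_inv] at this

/-- `R(b)ᵀ` is block-diagonal on the same left cosets. [cite: LinPryadko2024, §IV.C (arXiv:2306.16400 chunk p0010 L3–6, L22–26)] -/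
theorem transpose_rightMul_eq_zero_of_lcLabel_ne [Zero R] {b : G → R} {K : Subgroup G}
    (hK : ∀ g, b g ≠ 0 → g ∈ K) (α β : G) (hne : lcLabel K α ≠ lcLabel K β) : (rightMul b)ᵀ α β = 0 := by
  rw [transpose_apply]
  exact rightMul_eq_zero_of_lcLabel_ne hK β α (Ne.symm hne)

variable [Fintype G]

/-- A right coset `Hβ₀` has `|H|` elements: the block of `rcLabel H` through `β₀`.
[cite: LinPryadko2024, §IV.C "A = A₁ ⊗ I_{m_a}" (blocks of size |G_a|; arXiv:2306.16400 chunk p0010 L14–22)] -/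
theorem card_filter_rcLabel (H : Subgroup G) [DecidablePred (· ∈ H)] [DecidableEq (G ⧸ H)] (β₀ : G) :
    (Finset.univ.filter fun α => rcLabel H α = rcLabel H β₀).card = Nat.card H := by
  have e : {α // rcLabel H α = rcLabel H β₀} ≃ H :=
    { toFun := fun x => ⟨x.1 * β₀⁻¹, rcLabel_eq_iff.1 x.2⟩
      invFun := fun h => ⟨h.1 * β₀, rcLabel_eq_iff.2 (by rw [mul_inv_cancel_right]; exact h.2)⟩
      left_inv := fun x => Subtype.ext (by simp)
      right_inv := fun h => Subtype.ext (by simp) }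
  rw [Nat.card_eq_fintype_card, ← Fintype.card_congr e, Fintype.card_subtype]

/-- A left coset `β₀K` has `|K|` elements. [cite: LinPryadko2024, §IV.C "B = S(I_{m_b} ⊗ B₁)S⁻¹" (arXiv:2306.16400 chunk p0010 L22–26)] -/
theorem card_filter_lcLabel (K : Subgroup G) [DecidablePred (· ∈ K)] [DecidableEq (G ⧸ K)] (β₀ : G) :
    (Finset.univ.filter fun α => lcLabel K α = lcLabel K β₀).card = Nat.card K := by
  have e : {α // lcLabel K α = lcLabel K β₀} ≃ K :=
    { toFun := fun x => ⟨x.1⁻¹ * β₀, lcLabel_eq_iff.1 x.2⟩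
      invFun := fun k => ⟨β₀ * k.1⁻¹, lcLabel_eq_iff.2 (by
        rw [_root_.mul_inv_rev, inv_inv, mul_assoc, inv_mul_cancel, mul_one]; exact k.2)⟩
      left_inv := fun x => Subtype.ext (by simp)
      right_inv := fun k => Subtype.ext (by simp) }
  rw [Nat.card_eq_fintype_card, ← Fintype.card_congr e, Fintype.card_subtype]

/-- Every block of `rcLabel H` has `≤ |H|` elements. [cite: LinPryadko2024, §IV.C (arXiv:2306.16400 chunk p0010 L14–22)] -/
theorem card_filter_rcLabel_le (H : Subgroup G) [DecidablePred (· ∈ H)] [DecidableEq (G ⧸ H)] (c : G ⧸ H) :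
    (Finset.univ.filter fun α => rcLabel H α = c).card ≤ Nat.card H := by
  induction c using QuotientGroup.induction_on with
  | H g =>
    have : (g : G ⧸ H) = rcLabel H g⁻¹ := by rw [rcLabel, inv_inv]
    rw [this, card_filter_rcLabel]

/-- Every block of `lcLabel K` has `≤ |K|` elements. [cite: LinPryadko2024, §IV.C (arXiv:2306.16400 chunk p0010 L22–26)] -/
theorem card_filter_lcLabel_le (K : Subgroup G) [DecidablePred (· ∈ K)] [DecidableEq (G ⧸ K)] (c : G ⧸ K) :
    (Finset.univ.filter fun α => lcLabel K α = c).card ≤ Nat.card K := by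
  induction c using QuotientGroup.induction_on with
  | H g => exact (card_filter_lcLabel K g).le

/-! ### Single-block logical operators of weight at most `|G_a|`, `|G_b|` (any field) -/

section AnyField

variable {F : Type*} [Field F] [DecidableEq F]

/-- If `ker L(a) ∩ ker R(b) ≠ 0` there is a non-trivial `Z`-codeword `(u; 0)` of the two-block code with
`wgt u ≤ |G_a|` (Statement 4 for the block-diagonal `A = L(a)`).
[cite: LinPryadko2024, §IV.E "guarantees the condition of Statement 4, giving a simple upper bound on the distance in terms of matrix block sizes, d ≤ min(|G_a|,|G_b|)" (arXiv:2306.16400 chunk p0011 L66–70)] -/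
theorem exists_zLogical_wt_le_left (a b : G → F)
    (h : LinearMap.ker (leftMul a).mulVecLin ⊓ LinearMap.ker (rightMul b).mulVecLin ≠ ⊥) :
    ∃ u, Sum.elim u (0 : G → F) ∈ pcCode (TwoBlock.HX (leftMul a) (rightMul b)) ∧
      Sum.elim u (0 : G → F) ∉ rowSpace (TwoBlock.HZ (leftMul a) (rightMul b)) ∧
      hammingNorm u ≤ Nat.card (suppGroup a) := by
  classical
  obtain ⟨u, hu, hu', hwt⟩ := TwoBlock.exists_mem_ker_not_mem_map_wt_le (leftMul_mul_rightMul_comm a b)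
    (blk := rcLabel (suppGroup a)) (leftMul_eq_zero_of_rcLabel_ne fun g hg => mem_suppGroup_of_ne_zero hg)
    (card_filter_rcLabel_le (suppGroup a)) h
  exact ⟨u, (TwoBlock.statement3b hu hu').1, (TwoBlock.statement3b hu hu').2.2, hwt⟩

/-- If `ker L(a) ∩ ker R(b) ≠ 0` there is a non-trivial `Z`-codeword `(0; v)` with `wgt v ≤ |G_b|` (Statement 4
for `B = R(b)`, `μ = R`). [cite: LinPryadko2024, §IV.E "d ≤ min(|G_a|,|G_b|)" (arXiv:2306.16400 chunk p0011 L66–70)] -/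
theorem exists_zLogical_wt_le_right (a b : G → F)
    (h : LinearMap.ker (leftMul a).mulVecLin ⊓ LinearMap.ker (rightMul b).mulVecLin ≠ ⊥) :
    ∃ v, Sum.elim (0 : G → F) v ∈ pcCode (TwoBlock.HX (leftMul a) (rightMul b)) ∧
      Sum.elim (0 : G → F) v ∉ rowSpace (TwoBlock.HZ (leftMul a) (rightMul b)) ∧
      hammingNorm v ≤ Nat.card (suppGroup b) := by
  classical
  obtain ⟨v, hv, hv', hwt⟩ := TwoBlock.exists_mem_ker_not_mem_map_wt_le
    (leftMul_mul_rightMul_comm a b).symm (blk := lcLabel (suppGroup b))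
    (rightMul_eq_zero_of_lcLabel_ne fun g hg => mem_suppGroup_of_ne_zero hg)
    (card_filter_lcLabel_le (suppGroup b)) (by rwa [inf_comm])
  exact ⟨v, (TwoBlock.statement3b_right hv hv').1, (TwoBlock.statement3b_right hv hv').2, hwt⟩

/-- If `ker L(a)ᵀ ∩ ker R(b)ᵀ ≠ 0` there is a non-trivial `X`-codeword `(u; 0)` with `wgt u ≤ |G_b|` (Statement 4
for the block-diagonal `R(b)ᵀ`). [cite: LinPryadko2024, §IV.E with App. A.5 (CSS symmetry) (arXiv:2306.16400 chunks p0011 L66–70, p0016 L90–93)] -/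
theorem exists_xLogical_wt_le_left (a b : G → F)
    (h : LinearMap.ker (leftMul a)ᵀ.mulVecLin ⊓ LinearMap.ker (rightMul b)ᵀ.mulVecLin ≠ ⊥) :
    ∃ u, Sum.elim u (0 : G → F) ∈ pcCode (TwoBlock.HZ (leftMul a) (rightMul b)) ∧
      Sum.elim u (0 : G → F) ∉ rowSpace (TwoBlock.HX (leftMul a) (rightMul b)) ∧
      hammingNorm u ≤ Nat.card (suppGroup b) := by
  classical
  have hc : (rightMul b)ᵀ * (leftMul a)ᵀ = (leftMul a)ᵀ * (rightMul b)ᵀ := by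
    rw [← transpose_mul, ← transpose_mul, leftMul_mul_rightMul_comm]
  obtain ⟨u, hu, hu', hwt⟩ := TwoBlock.exists_mem_ker_not_mem_map_wt_le hc (blk := lcLabel (suppGroup b))
    (transpose_rightMul_eq_zero_of_lcLabel_ne fun g hg => mem_suppGroup_of_ne_zero hg)
    (card_filter_lcLabel_le (suppGroup b)) (by rwa [inf_comm])
  exact ⟨u, (TwoBlock.statement3b_X_left hu hu').1, (TwoBlock.statement3b_X_left hu hu').2, hwt⟩

/-- If `ker L(a)ᵀ ∩ ker R(b)ᵀ ≠ 0` there is a non-trivial `X`-codeword `(0; v)` with `wgt v ≤ |G_a|` (Statement 4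
for `L(a)ᵀ`). [cite: LinPryadko2024, §IV.E with App. A.5 (arXiv:2306.16400 chunks p0011 L66–70, p0016 L90–93)] -/
theorem exists_xLogical_wt_le_right (a b : G → F)
    (h : LinearMap.ker (leftMul a)ᵀ.mulVecLin ⊓ LinearMap.ker (rightMul b)ᵀ.mulVecLin ≠ ⊥) :
    ∃ v, Sum.elim (0 : G → F) v ∈ pcCode (TwoBlock.HZ (leftMul a) (rightMul b)) ∧
      Sum.elim (0 : G → F) v ∉ rowSpace (TwoBlock.HX (leftMul a) (rightMul b)) ∧
      hammingNorm v ≤ Nat.card (suppGroup a) := by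
  classical
  have hc : (leftMul a)ᵀ * (rightMul b)ᵀ = (rightMul b)ᵀ * (leftMul a)ᵀ := by
    rw [← transpose_mul, ← transpose_mul, leftMul_mul_rightMul_comm]
  obtain ⟨v, hv, hv', hwt⟩ := TwoBlock.exists_mem_ker_not_mem_map_wt_le hc (blk := rcLabel (suppGroup a))
    (transpose_leftMul_eq_zero_of_rcLabel_ne fun g hg => mem_suppGroup_of_ne_zero hg)
    (card_filter_rcLabel_le (suppGroup a)) h
  exact ⟨v, (TwoBlock.statement3b_X_right hv hv').1, (TwoBlock.statement3b_X_right hv hv').2, hwt⟩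

end AnyField

/-! ### The binary code `LP[a,b] = TwoBlockGA.css a b`: `min(d_X, d_Z) ≤ min(|G_a|, |G_b|)` whenever `k > 0` -/

section Binary

/-- `k(LP[a,b]) = dim(ker L(a) ∩ ker R(b)) + dim(ker L(a)ᵀ ∩ ker R(b)ᵀ)` (the tree's choice-free dimension
formula, instantiated). [cite: LinPryadko2024, §II.B "k = n − rank H_X − rank H_Z" (arXiv:2306.16400 chunk p0005 L28–31); BravyiEtAl2024 Lemma 1 kernel count] -/
theorem css_k_eq_finrank_ker_inf_add (a b : G → ZMod 2) :
    (css a b).k = finrank (ZMod 2) ↥(LinearMap.ker (leftMul a).mulVecLin ⊓ LinearMap.ker (rightMul b).mulVecLin) +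
      finrank (ZMod 2) ↥(LinearMap.ker (leftMul a)ᵀ.mulVecLin ⊓ LinearMap.ker (rightMul b)ᵀ.mulVecLin) := by
  rw [← TwoBlock.dim_eq_finrank_ker_inf_add, CSSCode.k_eq, css_HX, css_HZ, ← TwoBlock.HX_leftMul_rightMul,
    ← TwoBlock.HZ_leftMul_rightMul, Fintype.card_sum, ← two_mul]
  rfl

/-- **`d_Z ≤ |G_a|` and `d_Z ≤ |G_b|`** when `ker L(a) ∩ ker R(b) ≠ 0`.
[cite: LinPryadko2024, §IV.E "d ≤ min(|G_a|,|G_b|)" (arXiv:2306.16400 chunk p0011 L66–70)] -/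
theorem css_dZ_le_card_suppGroup (a b : G → ZMod 2)
    (h : LinearMap.ker (leftMul a).mulVecLin ⊓ LinearMap.ker (rightMul b).mulVecLin ≠ ⊥) :
    (css a b).dZ ≤ Nat.card (suppGroup a) ∧ (css a b).dZ ≤ Nat.card (suppGroup b) := by
  have hZ : (css a b).rowSpZ = rowSpace (TwoBlock.HZ (leftMul a) (rightMul b)) := by
    rw [CSSCode.rowSpZ, css_HZ, TwoBlock.HZ_leftMul_rightMul]
  constructor
  · obtain ⟨u, hu, hu', hwt⟩ := exists_zLogical_wt_le_left a b h
    refine le_trans ((css a b).dZ_le_hammingNorm hu (by rwa [hZ])) ?_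
    rwa [hammingNorm_sumElim, hammingNorm_zero, add_zero]
  · obtain ⟨v, hv, hv', hwt⟩ := exists_zLogical_wt_le_right a b h
    refine le_trans ((css a b).dZ_le_hammingNorm hv (by rwa [hZ])) ?_
    rwa [hammingNorm_sumElim, hammingNorm_zero, zero_add]

/-- **`d_X ≤ |G_a|` and `d_X ≤ |G_b|`** when `ker L(a)ᵀ ∩ ker R(b)ᵀ ≠ 0`.
[cite: LinPryadko2024, §IV.E "d ≤ min(|G_a|,|G_b|)" (arXiv:2306.16400 chunk p0011 L66–70)] -/
theorem css_dX_le_card_suppGroup (a b : G → ZMod 2)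
    (h : LinearMap.ker (leftMul a)ᵀ.mulVecLin ⊓ LinearMap.ker (rightMul b)ᵀ.mulVecLin ≠ ⊥) :
    (css a b).dX ≤ Nat.card (suppGroup a) ∧ (css a b).dX ≤ Nat.card (suppGroup b) := by
  have hZ : (css a b).HZ = TwoBlock.HZ (leftMul a) (rightMul b) := by
    rw [css_HZ, TwoBlock.HZ_leftMul_rightMul]
  constructor
  · obtain ⟨v, hv, hv', hwt⟩ := exists_xLogical_wt_le_right a b h
    refine le_trans ((css a b).dX_le_hammingNorm (by rw [hZ]; exact hv) hv') ?_
    rwa [hammingNorm_sumElim, hammingNorm_zero, zero_add]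
  · obtain ⟨u, hu, hu', hwt⟩ := exists_xLogical_wt_le_left a b h
    refine le_trans ((css a b).dX_le_hammingNorm (by rw [hZ]; exact hu) hu') ?_
    rwa [hammingNorm_sumElim, hammingNorm_zero, add_zero]

/-- **Lin–Pryadko 2024, §IV.E: `d ≤ min(|G_a|, |G_b|)` for EVERY binary 2BGA code `LP[a,b]` with `k > 0`,
over an arbitrary finite group** — no rank-defect hypothesis (`k > 0` makes one of `ker A ∩ ker B`,
`ker Aᵀ ∩ ker Bᵀ` non-zero, and Statement 4 applies in that sector).
[cite: LinPryadko2024, §IV.E "giving a simple upper bound on the distance in terms of matrix block sizes, d ≤ min(|G_a|,|G_b|)" (arXiv:2306.16400 chunk p0011 L66–70)] -/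
theorem css_min_dX_dZ_le_card_suppGroup (a b : G → ZMod 2) (hk : 0 < (css a b).k) :
    min (css a b).dX (css a b).dZ ≤ min (Nat.card (suppGroup a)) (Nat.card (suppGroup b)) := by
  rw [css_k_eq_finrank_ker_inf_add] at hk
  by_cases hZ : LinearMap.ker (leftMul a).mulVecLin ⊓ LinearMap.ker (rightMul b).mulVecLin = ⊥
  · have hX : LinearMap.ker (leftMul a)ᵀ.mulVecLin ⊓ LinearMap.ker (rightMul b)ᵀ.mulVecLin ≠ ⊥ := by
      intro hX
      rw [hZ, hX, finrank_bot] at hk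
      exact lt_irrefl 0 hk
    obtain ⟨h1, h2⟩ := css_dX_le_card_suppGroup a b hX
    exact (min_le_left _ _).trans (le_min h1 h2)
  · obtain ⟨h1, h2⟩ := css_dZ_le_card_suppGroup a b hZ
    exact (min_le_right _ _).trans (le_min h1 h2)

/-- Census form: an `[[n, k, d]]` 2BGA code has `d ≤ |G_a|` and `d ≤ |G_b|`.
[cite: LinPryadko2024, §IV.E "d ≤ min(|G_a|,|G_b|)" (arXiv:2306.16400 chunk p0011 L66–70)] -/
theorem le_card_suppGroup_of_isCode {a b : G → ZMod 2} {n k d : ℕ} (h : (css a b).IsCode n k d) :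
    d ≤ Nat.card (suppGroup a) ∧ d ≤ Nat.card (suppGroup b) := by
  have hk : 0 < (css a b).k := h.2.1.symm ▸ h.k_pos
  obtain ⟨-, -, hd⟩ := ((css a b).isCode_iff hk).1 h
  have := css_min_dX_dZ_le_card_suppGroup a b hk
  rw [hd] at this
  exact ⟨this.trans (min_le_left _ _), this.trans (min_le_right _ _)⟩

end Binary

end TwoBlockGA

/-! ### Abelian packaging: GB / BB / abelian 2BGA codes `AbelianTwoBlock.css a b` -/

namespace AbelianTwoBlock

variable {G : Type*} [AddCommGroup G] [Fintype G]

omit [Fintype G] in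
/-- The support group of `a` read in `Multiplicative G` is the additive support subgroup `⟨supp a⟩`.
[cite: LinPryadko2024, §IV.C "G_a ≡ ⟨{g ∈ G : a_g ≠ 0}⟩" (arXiv:2306.16400 chunk p0009 L116–121)] -/
theorem suppGroup_multiplicative (a : G → ZMod 2) :
    TwoBlockGA.suppGroup (G := Multiplicative G) (fun g => a g.toAdd) =
      (AddSubgroup.closure {g : G | a g ≠ 0}).toSubgroup := by
  rw [AddSubgroup.toSubgroup_closure]
  rfl

omit [Fintype G] in
/-- … and has the same order. [cite: LinPryadko2024, §IV.C (arXiv:2306.16400 chunk p0009 L116–121)] -/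
theorem card_suppGroup_multiplicative (a : G → ZMod 2) :
    Nat.card (TwoBlockGA.suppGroup (G := Multiplicative G) fun g => a g.toAdd) =
      Nat.card (AddSubgroup.closure {g : G | a g ≠ 0}) := by
  rw [suppGroup_multiplicative]
  exact Nat.card_congr (Equiv.subtypeEquiv Multiplicative.toAdd fun _ => Iff.rfl)

/-- **`d ≤ min(|G_a|, |G_b|)` for every abelian two-block code with `k > 0`** (GB: `G = ℤ_ℓ`; BB:
`G = ℤ_ℓ × ℤ_m`; abelian 2BGA), `G_a = ⟨supp a⟩`, `G_b = ⟨supp b⟩` the additive support subgroups: an a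
priori upper bound on the distance of a census row from the supports alone.
[cite: LinPryadko2024, §IV.E "d ≤ min(|G_a|,|G_b|)" (arXiv:2306.16400 chunk p0011 L66–70)] -/
theorem css_min_dX_dZ_le_card_closure (a b : G → ZMod 2) (hk : 0 < (css a b).k) :
    min (css a b).dX (css a b).dZ ≤
      min (Nat.card (AddSubgroup.closure {g : G | a g ≠ 0})) (Nat.card (AddSubgroup.closure {g : G | b g ≠ 0})) := by
  obtain ⟨hX, hZ, hK⟩ := TwoBlockGA.css_params_eq_abelian a b
  have h := TwoBlockGA.css_min_dX_dZ_le_card_suppGroup (G := Multiplicative G) (fun g => a g.toAdd)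
    (fun g => b g.toAdd) (by rw [hK]; exact hk)
  rwa [hX, hZ, card_suppGroup_multiplicative, card_suppGroup_multiplicative] at h

/-- Census form (abelian): an `[[n, k, d]]` abelian two-block code has `d ≤ |⟨supp a⟩|` and `d ≤ |⟨supp b⟩|`.
[cite: LinPryadko2024, §IV.E "d ≤ min(|G_a|,|G_b|)" (arXiv:2306.16400 chunk p0011 L66–70)] -/
theorem le_card_closure_of_isCode {a b : G → ZMod 2} {n k d : ℕ} (h : (css a b).IsCode n k d) :
    d ≤ Nat.card (AddSubgroup.closure {g : G | a g ≠ 0}) ∧ d ≤ Nat.card (AddSubgroup.closure {g : G | b g ≠ 0}) := by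
  have hk : 0 < (css a b).k := h.2.1.symm ▸ h.k_pos
  obtain ⟨-, -, hd⟩ := ((css a b).isCode_iff hk).1 h
  have := css_min_dX_dZ_le_card_closure a b hk
  rw [hd] at this
  exact ⟨this.trans (min_le_left _ _), this.trans (min_le_right _ _)⟩

end AbelianTwoBlock

end Literature.InformationTheory.QuantumCodes
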